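import Summits.MatrixMultiplication.MatrixMultiplication.Theorems.SoloBlindHypergraphRealiseK3
import Mathlib.Tactic.TFAE

/-!
# Four equivalent forms of the Kraft inequality for zero-sum-free sequences over exponent-3 groups

Sub-programme (K₃), summary file.  Named universe-level propositions for the four statements certified
equivalent in `SoloBlindConeLift` (E ⟺ (K₃): cone lift / virtual point), `SoloBlindHypergraph` +
`SoloBlindHypergraphRealise` (E ⟺ (♣)) and `SoloBlindHypergraphK3` + `SoloBlindHypergraphRealiseK3` ((K₃) ⟺ (♦)):

* `soloBlindFormKraft`    (K₃): `soloBlindMass h S σ ≤ 1` for every zero-sum-free `h` on `S` and every target `σ`;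
* `soloBlindFormConjE`    E:    `soloBlindMass h S τ ≤ 1/2` for every zero-sum-free `h` and every H-good target `τ`;
* `soloBlindFormClubs`    (♣): every admissible hypergraph has `∑_v 2^{-deg v} ≤ 1/2`;
* `soloBlindFormDiamonds` (♦): every balanced hypergraph has `∑_v 2^{-deg v} ≤ 1`;

all quantified over the index / group / vertex types of one universe `Type u`, and `soloBlind_forms_tfae`.
-/

namespace Summit.MatrixMultiplication.MatrixMultiplication.Theorems

open Finset

universe u

/-- FORM (K₃): the Kraft inequality for zero-sum-free sequences in exponent-`3` groups (universe `u`). -/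
def soloBlindFormKraft : Prop :=
  ∀ {κ : Type u} {G' : Type u} [AddCommGroup G'] [DecidableEq G'],
    (∀ g : G', g + g + g = 0) → ∀ (h' : κ → G') (S' : Finset κ) (σ' : G'),
    (∀ T ⊆ S', T.Nonempty → ∑ i ∈ T, h' i ≠ 0) → soloBlindMass h' S' σ' ≤ 1

/-- FORM E: H-good targets of zero-sum-free sequences carry mass at most `1/2` (universe `u`). -/
def soloBlindFormConjE : Prop :=
  ∀ {κ : Type u} {G' : Type u} [AddCommGroup G'] [DecidableEq G'],
    (∀ g : G', g + g + g = 0) → ∀ (h' : κ → G') (S' : Finset κ) (τ' : G'),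
    (∀ T ⊆ S', T.Nonempty → ∑ i ∈ T, h' i ≠ 0) → (∀ T ⊆ S', ∑ i ∈ T, h' i ≠ τ' + τ') →
    soloBlindMass h' S' τ' ≤ 1 / 2

/-- FORM (♣): the hypergraph Kraft conjecture over every vertex type of universe `u`. -/
def soloBlindFormClubs : Prop :=
  ∀ {W : Type u} [DecidableEq W], soloBlindHgKraftConj W

/-- FORM (♦): the balanced hypergraph Kraft conjecture over every vertex type of universe `u`. -/
def soloBlindFormDiamonds : Prop :=
  ∀ {W : Type u} [DecidableEq W], soloBlindHgKraftOneConj W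

/-- E ⟺ (K₃) (cone lift and virtual point, `SoloBlindConeLift`). -/
theorem soloBlind_formConjE_iff_formKraft : soloBlindFormConjE.{u} ↔ soloBlindFormKraft.{u} := by
  constructor
  · intro hE κ G' _ _ three h' S' σ' zsf'
    exact soloBlind_kraft_of_conjE hE three h' S' zsf' σ'
  · intro hK κ G' _ _ three h' S' τ' zsf' hgood'
    exact soloBlind_conjE_of_kraft hK three h' S' zsf' τ' hgood'

/-- E ⟺ (♣) (atom hypergraph and realisation). -/
theorem soloBlind_formConjE_iff_formClubs : soloBlindFormConjE.{u} ↔ soloBlindFormClubs.{u} :=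
  soloBlind_conjE_iff_hgKraft

/-- (K₃) ⟺ (♦) (atom hypergraph and realisation). -/
theorem soloBlind_formKraft_iff_formDiamonds : soloBlindFormKraft.{u} ↔ soloBlindFormDiamonds.{u} := by
  constructor
  · intro hK W _
    apply soloBlind_hgKraftOne_of_kraft
    intro κ G' _ _ three h' S' zsf' τ'
    exact hK three h' S' τ' zsf'
  · intro hC κ G' _ _ three h' S' σ' zsf'
    classical
    exact soloBlind_kraft_of_hgKraftOne hC three h' S' zsf' σ'

/-- THE FOUR FORMS ARE EQUIVALENT. -/
theorem soloBlind_forms_tfae :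
    List.TFAE [soloBlindFormKraft.{u}, soloBlindFormConjE.{u}, soloBlindFormClubs.{u},
      soloBlindFormDiamonds.{u}] := by
  tfae_have 1 ↔ 2 := soloBlind_formConjE_iff_formKraft.symm
  tfae_have 2 ↔ 3 := soloBlind_formConjE_iff_formClubs
  tfae_have 1 ↔ 4 := soloBlind_formKraft_iff_formDiamonds
  tfae_finish

end Summit.MatrixMultiplication.MatrixMultiplication.Theorems
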